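import Summits.CriticalPhenomena.SAWScalingLimit.Theorems.BoundaryTP2Negative_Box3
import Literature.Probability.LatticeModels.LatticeDobrushinBox

/-!
# `SimplyConnectedSpace Ω` does not exclude holes in `Ω_δ`

A bounded, open, star-convex (hence simply connected) `Ω` — the open square `(-½, 5/2)²` minus the zero-width
ray `{(1+s, 1+2s) : s ≥ 0}` issuing from the centre site — whose discrete domain `Ω_1` is the 8-cycle
`∂{0,1,2}²` (ℤ² induced on the 3 × 3 box minus its centre): an "annulus" graph.  So the hypotheses
`IsBounded Ω`, `SimplyConnectedSpace Ω` of `BoundaryTP2` do not force `Ω_δ` to be hole-free. [folklore]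
-/

namespace Summit.CriticalPhenomena.SAWScalingLimit.Theorems.BoundaryTP2.Negative

open Literature.Probability.LatticeModels Complex

noncomputable section

/-- The ray (tail) from `p` pointing away from `c`: `{p + t (p - c) : t ≥ 0}`. [folklore] -/
def tail (c p : ℂ) : Set ℂ := {z | ∃ t : ℝ, 0 ≤ t ∧ z = p + (t : ℂ) * (p - c)}

/-- Removing a tail pointing away from the star centre keeps star-convexity. [folklore] -/
theorem starConvex_diff_tail {s : Set ℂ} {c p : ℂ} (hs : StarConvex ℝ c s) (hpc : p ≠ c) :
    StarConvex ℝ c (s \ tail c p) := by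
  rw [starConvex_iff_segment_subset] at hs ⊢
  intro z hz w hw
  refine ⟨hs hz.1 hw, ?_⟩
  rintro ⟨t, ht, hwt⟩
  rw [segment_eq_image'] at hw
  obtain ⟨θ, ⟨hθ0, hθ1⟩, rfl⟩ := hw
  simp only [Complex.real_smul] at hwt
  -- hwt : c + θ (z - c) = p + t (p - c)
  have hθ : θ ≠ 0 := by
    rintro rfl
    simp only [Complex.ofReal_zero, zero_mul, add_zero] at hwt
    have h0 : ((1 : ℂ) + t) * (p - c) = 0 := by linear_combination -hwt
    rcases mul_eq_zero.1 h0 with h | h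
    · have h' : ((1 + t : ℝ) : ℂ) = 0 := by push_cast; exact h
      have : (1 : ℝ) + t = 0 := by exact_mod_cast h'
      linarith
    · exact hpc (sub_eq_zero.1 h)
  apply hz.2
  have hθpos : 0 < θ := lt_of_le_of_ne hθ0 (Ne.symm hθ)
  refine ⟨(1 + t) / θ - 1, ?_, ?_⟩
  · rw [le_sub_iff_add_le, zero_add, le_div_iff₀ hθpos, one_mul]
    linarith
  · have hθc : (θ : ℂ) ≠ 0 := by exact_mod_cast hθ
    have hz : z = c + (θ : ℂ)⁻¹ * (p + (t : ℂ) * (p - c) - c) := by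
      rw [← hwt]; field_simp; ring
    rw [hz]
    push_cast
    field_simp
    ring

/-- The annular domain: the open square minus the tail from the centre `1 + i` away from `c⋆ = ½`.
[folklore] -/
def Ωann : Set ℂ := openBox ![0, 0] ![2, 2] \ tail ((1 : ℂ) / 2) (1 + Complex.I)

/-- The star centre `½` lies in the open square. [folklore] -/
theorem half_mem_openBox : ((1 : ℂ) / 2) ∈ openBox ![0, 0] ![2, 2] := by
  simp only [openBox, Set.mem_setOf_eq, Matrix.cons_val_zero, Matrix.cons_val_one, Int.cast_zero, Int.cast_ofNat]
  norm_num

/-- `Ωann` is star-convex with centre `½`, hence simply connected. [folklore] -/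
theorem simplyConnectedSpace_Ωann : SimplyConnectedSpace Ωann := by
  have hc : ((1 : ℂ) / 2) ∈ Ωann := by
    refine ⟨half_mem_openBox, ?_⟩
    rintro ⟨t, ht, h⟩
    have := congrArg Complex.im h
    simp at this
    nlinarith
  have hstar : StarConvex ℝ ((1 : ℂ) / 2) Ωann :=
    starConvex_diff_tail ((convex_openBox ![0, 0] ![2, 2]).starConvex half_mem_openBox) (by
      intro h; have := congrArg Complex.im h; simp at this)
  haveI := hstar.contractibleSpace ⟨_, hc⟩
  infer_instance

/-- `Ωann` is bounded. [folklore] -/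
theorem isBounded_Ωann : Bornology.IsBounded Ωann :=
  ((isBounded_siteDomain (boxSites_finite ![0, 0] ![2, 2])).subset
    (by rw [siteDomain_boxSites]; exact fun z hz => hz.1)) 


/-! ### The discrete domain of `Ωann` is the 8-cycle -/

/-- The eight sites of the box other than its centre. [folklore] -/
def V₈ : Set (Site 2) := boxSites ![0, 0] ![2, 2] \ {![1, 1]}

/-- A box site lies on the removed tail iff it is the centre. [folklore] -/
theorem toComplex_mem_tail_iff {x : Site 2} (hx : x ∈ boxSites ![0, 0] ![2, 2]) :
    Site.toComplex x ∈ tail ((1 : ℂ) / 2) (1 + Complex.I) ↔ x = ![1, 1] := by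
  rw [mem_boxSites_iff, Fin.forall_fin_two] at hx
  simp only [Matrix.cons_val_zero, Matrix.cons_val_one] at hx
  obtain ⟨⟨h0, h0'⟩, h1, h1'⟩ := hx
  constructor
  · rintro ⟨t, ht, h⟩
    have hre := congrArg Complex.re h
    have him := congrArg Complex.im h
    simp [Site.toComplex] at hre him
    -- hre : x 0 = 1 + t/2, him : x 1 = 1 + t
    have e1 : (x 1 : ℝ) = 1 + t := by linarith
    have e0 : (2 : ℝ) * x 0 = x 1 + 1 := by linarith
    have e0' : (2 : ℤ) * x 0 = x 1 + 1 := by exact_mod_cast e0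
    have ht1 : (1 : ℝ) ≤ x 1 := by linarith
    have ht1' : (1 : ℤ) ≤ x 1 := by exact_mod_cast ht1
    have hx1 : x 1 = 1 := by omega
    have hx0 : x 0 = 1 := by omega
    exact funext (Fin.forall_fin_two.2 ⟨hx0, hx1⟩)
  · rintro rfl
    refine ⟨0, le_rfl, ?_⟩
    apply Complex.ext <;> simp [Site.toComplex]

/-- **The mesh vertices of `Ωann` are the eight non-central box sites.** [folklore] -/
theorem meshVertices_Ωann : meshVertices Ωann 1 = V₈ := by
  ext x
  rw [mem_meshVertices_iff, meshPoint_one, Ωann, Set.mem_sdiff, ← siteDomain_boxSites,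
    toComplex_mem_siteDomain_iff, V₈, Set.mem_sdiff, Set.mem_singleton_iff]
  constructor
  · rintro ⟨hx, ht⟩
    exact ⟨hx, fun h => ht ((toComplex_mem_tail_iff hx).2 h)⟩
  · rintro ⟨hx, ht⟩
    exact ⟨hx, fun h => ht ((toComplex_mem_tail_iff hx).1 h)⟩

/-- The complement of the line carrying the tail is dense. [folklore] -/
theorem dense_compl_tailLine : Dense {z : ℂ | z.im ≠ 2 * z.re - 1} := by
  rw [Metric.dense_iff]
  intro z r hr
  by_cases hz : z.im = 2 * z.re - 1
  · refine ⟨z + (r / 2 : ℝ), ?_, ?_⟩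
    · rw [Metric.mem_ball, dist_eq_norm]
      simp [abs_of_pos hr]
      linarith
    · simp only [Set.mem_setOf_eq, Complex.add_re, Complex.add_im, Complex.ofReal_re, Complex.ofReal_im]
      intro h
      linarith
  · exact ⟨z, Metric.mem_ball_self hr, hz⟩

/-- The tail lies on that line. [folklore] -/
theorem tail_subset_line : tail ((1 : ℂ) / 2) (1 + Complex.I) ⊆ {z : ℂ | z.im = 2 * z.re - 1} := by
  rintro z ⟨t, -, rfl⟩
  simp only [Set.mem_setOf_eq, Complex.add_im, Complex.one_im, Complex.I_im, Complex.mul_im, Complex.ofReal_re,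
    Complex.sub_im, Complex.div_ofNat_im, Complex.ofReal_im, Complex.sub_re, Complex.add_re, Complex.one_re,
    Complex.I_re, Complex.div_ofNat_re, Complex.mul_re]
  ring

/-- The open square lies in the closure of `Ωann` (the tail is nowhere dense). [folklore] -/
theorem openBox_subset_closure_Ωann : openBox ![0, 0] ![2, 2] ⊆ closure Ωann := by
  have hopen : IsOpen (openBox ![0, 0] ![2, 2]) := by
    rw [← siteDomain_boxSites]; exact isOpen_siteDomain _
  refine (dense_compl_tailLine.open_subset_closure_inter hopen).trans (closure_mono ?_)
  rintro z ⟨hz, hl⟩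
  exact ⟨hz, fun ht => hl (tail_subset_line ht)⟩

/-- Neighbouring sites of `V₈` are joined in the mesh graph of `Ωann`. [folklore] -/
theorem meshGraph_Ωann_adj {x y : Site 2} (hx : x ∈ V₈) (hy : y ∈ V₈) (h : (zdGraph 2).Adj x y) :
    (meshGraph Ωann 1).Adj x y := by
  refine meshGraph_adj_iff.2 ⟨h, ?_⟩
  rw [meshPoint_one, meshPoint_one]
  refine Set.Subset.trans ?_ openBox_subset_closure_Ωann
  rw [← siteDomain_boxSites]
  obtain ⟨i, hi | hi⟩ := (zdGraph_adj_iff x y).1 h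
  · subst hi; exact segment_subset_siteDomain hx.1 hy.1
  · subst hi; rw [segment_symm]; exact segment_subset_siteDomain hy.1 hx.1

/-- Membership in `V₈`, decidably. [folklore] -/
instance decMemV₈ (x : Site 2) : Decidable (x ∈ V₈) :=
  decidable_of_iff (x ∈ boxSites ![0, 0] ![2, 2] ∧ x ≠ ![1, 1]) (by simp [V₈])

/-- The eight sites, explicitly. [folklore] -/
theorem mem_V₈_cases {x : Site 2} (hx : x ∈ V₈) :
    x = ![0, 0] ∨ x = ![1, 0] ∨ x = ![2, 0] ∨ x = ![2, 1] ∨ x = ![2, 2] ∨ x = ![1, 2] ∨ x = ![0, 2] ∨ x = ![0, 1] := by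
  obtain ⟨hb, hc⟩ := hx
  rw [mem_boxSites_iff, Fin.forall_fin_two] at hb
  simp only [Matrix.cons_val_zero, Matrix.cons_val_one] at hb
  obtain ⟨⟨h0, h0'⟩, h1, h1'⟩ := hb
  have hxe : x = ![x 0, x 1] := funext (Fin.forall_fin_two.2 ⟨rfl, rfl⟩)
  rw [Set.mem_singleton_iff, hxe] at hc
  rw [hxe]
  interval_cases (x 0) <;> interval_cases (x 1) <;> simp_all

/-- A mesh-graph step inside `V₈` from decidable data. [folklore] -/
theorem stepAnn {x y : Site 2} (h : (zdGraph 2).Adj x y ∧ x ∈ V₈ ∧ y ∈ V₈) :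
    (meshVertexGraph Ωann 1).Adj ⟨x, by rw [meshVertices_Ωann]; exact h.2.1⟩ ⟨y, by rw [meshVertices_Ωann]; exact h.2.2⟩ :=
  SimpleGraph.induce_adj.2 (meshGraph_Ωann_adj h.2.1 h.2.2 h.1)

/-- Every mesh vertex of `Ωann` is reachable from the corner `(0,0)` (walk around the 8-cycle). [folklore] -/
theorem reachable_Ωann (v : meshVertices Ωann 1) :
    (meshVertexGraph Ωann 1).Reachable ⟨![0, 0], by rw [meshVertices_Ωann]; decide⟩ v := by
  have hv : v.1 ∈ V₈ := by rw [← meshVertices_Ωann]; exact v.2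
  -- the eight consecutive steps
  have s1 := (stepAnn (x := ![0, 0]) (y := ![1, 0]) (by decide)).reachable
  have s2 := (stepAnn (x := ![1, 0]) (y := ![2, 0]) (by decide)).reachable
  have s3 := (stepAnn (x := ![2, 0]) (y := ![2, 1]) (by decide)).reachable
  have s4 := (stepAnn (x := ![2, 1]) (y := ![2, 2]) (by decide)).reachable
  have s5 := (stepAnn (x := ![2, 2]) (y := ![1, 2]) (by decide)).reachable
  have s6 := (stepAnn (x := ![1, 2]) (y := ![0, 2]) (by decide)).reachable
  have s7 := (stepAnn (x := ![0, 2]) (y := ![0, 1]) (by decide)).reachable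
  obtain ⟨x, hx⟩ := v
  simp only at hv
  rcases mem_V₈_cases hv with rfl | rfl | rfl | rfl | rfl | rfl | rfl | rfl
  · exact SimpleGraph.Reachable.refl _
  · exact s1
  · exact s1.trans s2
  · exact (s1.trans s2).trans s3
  · exact ((s1.trans s2).trans s3).trans s4
  · exact (((s1.trans s2).trans s3).trans s4).trans s5
  · exact ((((s1.trans s2).trans s3).trans s4).trans s5).trans s6
  · exact (((((s1.trans s2).trans s3).trans s4).trans s5).trans s6).trans s7

/-- The mesh vertex graph of `Ωann` is preconnected. [folklore] -/
theorem preconnected_Ωann : (meshVertexGraph Ωann 1).Preconnected :=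
  fun a b => (reachable_Ωann a).symm.trans (reachable_Ωann b)

/-- **The discrete domain of `Ωann` is all of `V₈`.** [folklore] -/
theorem meshDomain_Ωann : meshDomain Ωann 1 = V₈ := by
  refine Set.Subset.antisymm ((meshDomain_subset_meshVertices _ _).trans meshVertices_Ωann.subset) fun v hv => ?_
  have hv' : v ∈ meshVertices Ωann 1 := by rw [meshVertices_Ωann]; exact hv
  have hsub := preconnected_Ωann.subsingleton_connectedComponent
  simp only [meshDomain, Set.mem_iUnion, Set.mem_image]
  refine ⟨(meshVertexGraph Ωann 1).connectedComponentMk ⟨v, hv'⟩, fun C' => ?_, ⟨v, hv'⟩, ?_, rfl⟩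
  · rw [Subsingleton.elim C' ((meshVertexGraph Ωann 1).connectedComponentMk ⟨v, hv'⟩)]
  · rw [SimpleGraph.ConnectedComponent.mem_supp_iff]

/-- **The domain graph of `Ωann` is the 8-cycle**: `ℤ²` induced on the box minus its centre. [folklore] -/
theorem adjAnn_iff {x y : Site 2} :
    (discreteDomainGraph Ωann 1).Adj x y ↔ (zdGraph 2).Adj x y ∧ x ∈ V₈ ∧ y ∈ V₈ := by
  rw [discreteDomainGraph_adj_iff, meshDomain_Ωann]
  constructor
  · rintro ⟨h, hx, hy⟩
    exact ⟨meshGraph_le_zdGraph _ _ h, hx, hy⟩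
  · rintro ⟨h, hx, hy⟩
    exact ⟨meshGraph_Ωann_adj hx hy h, hx, hy⟩

/-- **`SimplyConnectedSpace Ω` and `IsBounded Ω` do not make `Ω_δ` hole-free**: there is a bounded, simply
connected (indeed open and star-convex) `Ω ⊆ ℂ` whose discrete domain at mesh `1` is the annular 8-cycle
`ℤ²[∂{0,1,2}²]`. [folklore] -/
theorem exists_simplyConnected_domain_with_annular_meshGraph :
    ∃ Ω : Set ℂ, Bornology.IsBounded Ω ∧ SimplyConnectedSpace Ω ∧
      ∀ x y : Site 2, (discreteDomainGraph Ω 1).Adj x y ↔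
        (zdGraph 2).Adj x y ∧ x ∈ boxSites ![0, 0] ![2, 2] \ {![1, 1]} ∧ y ∈ boxSites ![0, 0] ![2, 2] \ {![1, 1]} :=
  ⟨Ωann, isBounded_Ωann, simplyConnectedSpace_Ωann, fun _ _ => adjAnn_iff⟩

end

end Summit.CriticalPhenomena.SAWScalingLimit.Theorems.BoundaryTP2.Negative
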